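import Summits.NavierStokesRegularity.NavierStokesRegularity.Theorems.CoriolisHeadNoCoRotatingCoreEnergyIdentity
import HarnessLib

/-!
# Route CoriolisHead · crux `NoCoRotatingCore` (stmt-NavierStokesRegularity-22676) —
# a Gaussian-weighted energy Liouville theorem for the zero-feed spin-vorticity equation

Support file (`--supports stmt-NavierStokesRegularity-22676`; theorems only).  THE LEMMA
(`eq_zero_of_driftOp_eq_two_mul`).  Let `U ∈ C¹(ℝ³; ℝ³)` be bounded and divergence free, `B` skew,
`ν, a > 0`, and let `f ∈ C²(ℝ³)` solve `νΔf − Df[U − By + ay] = 2a f` with at most polynomial growth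
IN MEAN SQUARE ONLY, `∫_{B(0,R)} f² ≤ K (1 + R)^m` (`R ≥ 1`).  Then `f ≡ 0`.

PROOF (no maximum principle, no pointwise growth).  With `w = G χ_R`, `G = e^{−κ|y|²}`,
`κ = min(a/4ν, a²/4M²)`, the identity `(a/2)∫f²w + ν∫w|∇f|² = ½∫f²(νΔw + Dw[V])` and the pointwise
bound `νΔG + DG[V] ≤ (a/4)G` of `CoriolisHeadNoCoRotatingCoreEnergyIdentity` leave only cut-off
errors, which live on `R ≤ |y| ≤ 2R` where `G ≤ e^{−κR²}` beats the polynomial mean-square growth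
(`energy_cutoff_estimate`); `R → ∞` gives `∫_{B(0,ρ)} f² G = 0` for every `ρ`, i.e. `f ≡ 0`.

USE.  `CoriolisHeadNoCoRotatingCoreNoAxialVelocity` applies it to the spin vorticity
`ω_β = −tr(B∘DU) = ⟪β, curl U⟫` of a bounded rotated Leray profile WITHOUT AXIAL VELOCITY
(`⟪β, U⟫ ≡ 0`), for which the strain feed `⟪β, DU[ω]⟫` of `stub_spinVorticityIdentity` vanishes —
a decided sub-class (rung) of the crux.  HONEST FRAMING: nothing here proves `NoCoRotatingCore`,
bounded rotated-profile Liouville, or Navier–Stokes regularity.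

References: T.-P. Tsai, ARMA 143 (1998), proof of Lemma 3.1 [Tsai1998]; B. Pineau, V. Vicol,
arXiv:2607.09619, §2 [PineauVicol2026].
-/


noncomputable section

-- the summit and its single sub-problem share the name (CONVENTIONS §1), as in every Theorems file
set_option linter.dupNamespace false

open MeasureTheory Set Function Filter Topology InnerProductSpace Metric
open scoped RealInnerProductSpace Laplacian ContDiff BigOperators ENNReal NNReal
open Literature.Analysis.FluidPDE

namespace Summit.NavierStokesRegularity.NavierStokesRegularity.Theorems.CoriolisHead


section Liouville

variable {ν a : ℝ} {B : EuclideanSpace ℝ (Fin 3) →L[ℝ] EuclideanSpace ℝ (Fin 3)}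
  {U : EuclideanSpace ℝ (Fin 3) → EuclideanSpace ℝ (Fin 3)} {f : EuclideanSpace ℝ (Fin 3) → ℝ}

/-- **Energy inequality with the cut-off Gaussian weight.** Under the hypotheses of
`weighted_energy_identity`, with `|U| ≤ M`, the Gaussian bound of `gauss_weight_le` for
`G = e^{−κ|y|²}`, and the tree's cut-off `χ_R` (`‖Dχ_R‖ ≤ C₁/R`, `|Δχ_R| ≤ C₂/R²`), for every `R ≥ 1`
`(3a/8) ∫ f² G χ_R ≤ ½ E₀ e^{−κR²} ∫_{B(0,3R)} f²`, `E₀ = νC₂ + 36νκC₁ + C₁(M + 3(‖B‖ + a))`: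
the cut-off errors live where `R ≤ |y| ≤ 2R`, on which `G ≤ e^{−κR²}`. [folklore] -/
theorem energy_cutoff_estimate (hν : 0 < ν) (ha : 0 < a) (hB : ∀ x, ⟪B x, x⟫ = 0)
    (hU : ContDiff ℝ 1 U) (hdiv : VectorCalculus.IsDivFree U) (hf : ContDiff ℝ 2 f)
    (heq : ∀ y, driftOp ν a (fun z => U z - B z) f y = 2 * a * f y)
    {M : ℝ} (hM0 : 0 ≤ M) (hM : ∀ y, ‖U y‖ ≤ M) {κ : ℝ} (hκ0 : 0 < κ)
    (hmain : ∀ y, ν * (Δ (gaussProfile (-κ) : EuclideanSpace ℝ (Fin 3) → ℝ)) y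
        + fderiv ℝ (gaussProfile (-κ) : EuclideanSpace ℝ (Fin 3) → ℝ) y (U y - B y + a • y)
      ≤ a / 4 * gaussProfile (-κ) y)
    {C₁ C₂ : ℝ} (hC₁0 : 0 ≤ C₁) (hC₂0 : 0 ≤ C₂)
    (hC₁ : ∀ R : ℝ, 0 < R → ∀ x : EuclideanSpace ℝ (Fin 3), ‖fderiv ℝ (cutoff R) x‖ ≤ C₁ / R)
    (hC₂ : ∀ R : ℝ, 0 < R → ∀ x : EuclideanSpace ℝ (Fin 3),
      |(Δ (cutoff R : EuclideanSpace ℝ (Fin 3) → ℝ)) x| ≤ C₂ / R ^ 2)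
    {R : ℝ} (hR : 1 ≤ R) :
    3 * a / 8 * ∫ x, f x ^ 2 * (gaussProfile (-κ) x * cutoff R x)
      ≤ 1 / 2 * ((ν * C₂ + 36 * ν * κ * C₁ + C₁ * (M + 3 * (‖B‖ + a))) * Real.exp (-κ * R ^ 2))
          * ∫ x in ball (0 : EuclideanSpace ℝ (Fin 3)) (3 * R), f x ^ 2 := by
  set G : EuclideanSpace ℝ (Fin 3) → ℝ := gaussProfile (-κ) with hGdef
  set φ : EuclideanSpace ℝ (Fin 3) → ℝ := cutoff R with hφdef
  set E₀ : ℝ := ν * C₂ + 36 * ν * κ * C₁ + C₁ * (M + 3 * (‖B‖ + a)) with hE₀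
  have hR0 : 0 < R := by linarith
  have hE₀0 : 0 ≤ E₀ := by positivity
  have hG2 : ContDiff ℝ 2 G := contDiff_gaussProfile _
  have hφ2 : ContDiff ℝ 2 φ := contDiff_cutoff R
  have hG1 : ContDiff ℝ 1 G := hG2.of_le one_le_two
  have hφ1 : ContDiff ℝ 1 φ := hφ2.of_le one_le_two
  have hφc : HasCompactSupport φ := hasCompactSupport_cutoff hR0
  have hw2 : ContDiff ℝ 2 fun y => G y * φ y := hG2.mul hφ2
  have hwc : HasCompactSupport fun y => G y * φ y := hφc.mul_left
  have hGpos : ∀ x, 0 < G x := fun x => Real.exp_pos _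
  have hφnn : ∀ x, 0 ≤ φ x := fun x => cutoff_nonneg _ _
  have hGd : ∀ x, DifferentiableAt ℝ G x := fun x => (hG1.differentiable one_ne_zero) x
  have hφd : ∀ x, DifferentiableAt ℝ φ x := fun x => (hφ1.differentiable one_ne_zero) x
  have hfc : Continuous f := hf.continuous
  have hGc : Continuous G := hG2.continuous
  have hφcont : Continuous φ := hφ2.continuous
  have hDG : Continuous (fderiv ℝ G) := hG1.continuous_fderiv one_ne_zero
  have hDφ : Continuous (fderiv ℝ φ) := hφ1.continuous_fderiv one_ne_zero
  have hΔG : Continuous (Δ G) := continuous_laplacian hG2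
  have hΔφ : Continuous (Δ φ) := continuous_laplacian hφ2
  have hV1 : ContDiff ℝ 1 fun y => U y - B y + a • y :=
    (hU.sub B.contDiff).add (contDiff_id.const_smul a)
  have hVc : Continuous fun y => U y - B y + a • y := hV1.continuous
  have hid := weighted_energy_identity hU hdiv hB hf heq hw2 hwc
  have hDnn : 0 ≤ ∫ x, (G x * φ x)
      * ∑ i, (fderiv ℝ f x (EuclideanSpace.basisFun (Fin 3) ℝ i)) ^ 2 :=
    integral_nonneg fun x => mul_nonneg (mul_nonneg (hGpos x).le (hφnn x))
      (Finset.sum_nonneg fun i _ => sq_nonneg _)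
  have hA : a / 2 * (∫ x, f x ^ 2 * (G x * φ x))
      ≤ 1 / 2 * ∫ x, f x ^ 2 * (ν * (Δ fun y => G y * φ y) x
          + fderiv ℝ (fun y => G y * φ y) x (U x - B x + a • x)) := by
    have := mul_nonneg hν.le hDnn
    linarith
  set err : EuclideanSpace ℝ (Fin 3) → ℝ := fun x =>
    ν * (G x * (Δ φ) x + 2 * ∑ i, fderiv ℝ G x (EuclideanSpace.basisFun (Fin 3) ℝ i)
        * fderiv ℝ φ x (EuclideanSpace.basisFun (Fin 3) ℝ i))
      + G x * fderiv ℝ φ x (U x - B x + a • x) with herr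
  have hsplit : ∀ x, ν * (Δ fun y => G y * φ y) x
        + fderiv ℝ (fun y => G y * φ y) x (U x - B x + a • x)
      = φ x * (ν * (Δ G) x + fderiv ℝ G x (U x - B x + a • x)) + err x := fun x => by
    rw [laplacian_mul_eq (EuclideanSpace.basisFun (Fin 3) ℝ) hG2 hφ2 x, fderiv_fun_mul (hGd x) (hφd x)]
    simp only [herr, _root_.add_apply, _root_.FunLike.coe_smul, Pi.smul_apply, smul_eq_mul]
    ring
  have herrc : Continuous err := by
    refine (continuous_const.mul ((hGc.mul hΔφ).add (continuous_const.mul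
      (continuous_finsetSum _ fun i _ => (hDG.clm_apply continuous_const).mul
        (hDφ.clm_apply continuous_const))))).add (hGc.mul (hDφ.clm_apply hVc))
  have hφsupp : tsupport φ ⊆ closedBall (0 : EuclideanSpace ℝ (Fin 3)) (2 * R) :=
    tsupport_cutoff_subset hR0
  have herr_out : ∀ x, x ∉ tsupport φ → err x = 0 := fun x hx => by
    simp [herr, fderiv_of_notMem_tsupport ℝ hx, laplacian_eq_zero_of_notMem_tsupport hx]
  have herr_in : ∀ x : EuclideanSpace ℝ (Fin 3), ‖x‖ < R → err x = 0 := fun x hx => by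
    simp [herr, hφdef, fderiv_cutoff_eq_zero hR0 hx, laplacian_cutoff_eq_zero hR0 hx]
  have herrcs : HasCompactSupport err :=
    hφc.mono' fun x hx => by
      contrapose! hx
      exact notMem_support.2 (herr_out x hx)
  have herr_bd : ∀ x : EuclideanSpace ℝ (Fin 3), R ≤ ‖x‖ → ‖x‖ ≤ 3 * R →
      |err x| ≤ E₀ * Real.exp (-κ * R ^ 2) := by
    intro x hx1 hx2
    have hGx0 : 0 ≤ G x := (hGpos x).le
    have hGx : G x ≤ Real.exp (-κ * R ^ 2) := by
      show Real.exp (-κ * ‖x‖ ^ 2) ≤ Real.exp (-κ * R ^ 2)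
      apply Real.exp_le_exp.2
      have h1 : R ^ 2 ≤ ‖x‖ ^ 2 := pow_le_pow_left₀ hR0.le hx1 2
      have h2 := mul_le_mul_of_nonneg_left h1 hκ0.le
      linarith
    have hΔφx : |(Δ φ) x| ≤ C₂ := (hC₂ R hR0 x).trans (div_le_self hC₂0 (one_le_pow₀ hR))
    have hDφx : ‖fderiv ℝ φ x‖ ≤ C₁ / R := hC₁ R hR0 x
    have hbi : ∀ i, ‖EuclideanSpace.basisFun (Fin 3) ℝ i‖ = 1 := fun i =>
      (EuclideanSpace.basisFun (Fin 3) ℝ).orthonormal.1 i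
    have hDGi : ∀ i, |fderiv ℝ G x (EuclideanSpace.basisFun (Fin 3) ℝ i)| ≤ 2 * κ * (3 * R) * G x :=
      fun i => by
      have hfor : fderiv ℝ G x (EuclideanSpace.basisFun (Fin 3) ℝ i)
          = 2 * (-κ * G x) * ⟪x, EuclideanSpace.basisFun (Fin 3) ℝ i⟫ :=
        fderiv_gaussProfile_apply _ _ _
      have h1 : |⟪x, EuclideanSpace.basisFun (Fin 3) ℝ i⟫| ≤ ‖x‖ := by
        have := abs_real_inner_le_norm x (EuclideanSpace.basisFun (Fin 3) ℝ i)
        rwa [hbi i, mul_one] at this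
      rw [hfor, abs_mul, abs_mul, abs_mul, abs_neg, abs_of_pos (by norm_num : (0 : ℝ) < 2),
        abs_of_pos hκ0, abs_of_nonneg hGx0]
      calc 2 * (κ * G x) * |⟪x, EuclideanSpace.basisFun (Fin 3) ℝ i⟫|
          ≤ 2 * (κ * G x) * (3 * R) := mul_le_mul_of_nonneg_left (h1.trans hx2) (by positivity)
        _ = 2 * κ * (3 * R) * G x := by ring
    have hDφi : ∀ i, |fderiv ℝ φ x (EuclideanSpace.basisFun (Fin 3) ℝ i)| ≤ C₁ / R := fun i => by
      have := (fderiv ℝ φ x).le_opNorm (EuclideanSpace.basisFun (Fin 3) ℝ i)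
      rw [hbi i, mul_one, Real.norm_eq_abs] at this
      exact this.trans hDφx
    have hsum : |∑ i, fderiv ℝ G x (EuclideanSpace.basisFun (Fin 3) ℝ i)
        * fderiv ℝ φ x (EuclideanSpace.basisFun (Fin 3) ℝ i)|
        ≤ 3 * (2 * κ * (3 * R) * G x * (C₁ / R)) := by
      refine (Finset.abs_sum_le_sum_abs _ _).trans ?_
      have : ∀ i ∈ Finset.univ, |fderiv ℝ G x (EuclideanSpace.basisFun (Fin 3) ℝ i)
          * fderiv ℝ φ x (EuclideanSpace.basisFun (Fin 3) ℝ i)|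
          ≤ 2 * κ * (3 * R) * G x * (C₁ / R) := fun i _ => by
        rw [abs_mul]
        exact mul_le_mul (hDGi i) (hDφi i) (abs_nonneg _) (by positivity)
      refine (Finset.sum_le_sum this).trans ?_
      simp
    have hV : ‖U x - B x + a • x‖ ≤ M + (‖B‖ + a) * (3 * R) := by
      have h3 := mul_le_mul_of_nonneg_left hx2 (add_nonneg (norm_nonneg B) ha.le)
      calc ‖U x - B x + a • x‖ ≤ ‖U x‖ + ‖B x‖ + ‖a • x‖ := by
            refine (norm_add_le _ _).trans ?_
            gcongr
            exact norm_sub_le _ _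
        _ ≤ M + ‖B‖ * ‖x‖ + a * ‖x‖ := by
            gcongr
            · exact hM x
            · exact B.le_opNorm x
            · rw [norm_smul, Real.norm_eq_abs, abs_of_pos ha]
        _ ≤ M + (‖B‖ + a) * (3 * R) := by linarith
    have hlast : |G x * fderiv ℝ φ x (U x - B x + a • x)|
        ≤ G x * (C₁ / R * (M + (‖B‖ + a) * (3 * R))) := by
      rw [abs_mul, abs_of_nonneg hGx0]
      refine mul_le_mul_of_nonneg_left ?_ hGx0
      have := (fderiv ℝ φ x).le_opNorm (U x - B x + a • x)
      rw [Real.norm_eq_abs] at this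
      exact this.trans (mul_le_mul hDφx hV (norm_nonneg _) (by positivity))
    have hGE : |err x| ≤ G x * E₀ := by
      have t1 : |ν * (G x * (Δ φ) x + 2 * ∑ i, fderiv ℝ G x (EuclideanSpace.basisFun (Fin 3) ℝ i)
            * fderiv ℝ φ x (EuclideanSpace.basisFun (Fin 3) ℝ i))|
          ≤ ν * (G x * C₂ + 2 * (3 * (2 * κ * (3 * R) * G x * (C₁ / R)))) := by
        rw [abs_mul, abs_of_pos hν]
        refine mul_le_mul_of_nonneg_left ((abs_add_le _ _).trans (add_le_add ?_ ?_)) hν.le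
        · rw [abs_mul, abs_of_nonneg hGx0]; exact mul_le_mul_of_nonneg_left hΔφx hGx0
        · rw [abs_mul, abs_of_pos (by norm_num : (0:ℝ) < 2)]
          exact mul_le_mul_of_nonneg_left hsum (by norm_num)
      have t2 := (abs_add_le _ _).trans (add_le_add t1 hlast)
      refine t2.trans ?_
      have hRinv : C₁ / R * M ≤ C₁ * M := by
        rw [div_mul_eq_mul_div]
        exact div_le_self (by positivity) hR
      have hcanc : 2 * κ * (3 * R) * G x * (C₁ / R) = 6 * κ * C₁ * G x := by
        field_simp
        ring
      have hcanc2 : C₁ / R * ((‖B‖ + a) * (3 * R)) = 3 * C₁ * (‖B‖ + a) := by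
        field_simp
      rw [hcanc, mul_add (C₁ / R), hcanc2, hE₀]
      have := mul_le_mul_of_nonneg_left hRinv hGx0
      linarith
    calc |err x| ≤ G x * E₀ := hGE
      _ ≤ Real.exp (-κ * R ^ 2) * E₀ := mul_le_mul_of_nonneg_right hGx hE₀0
      _ = E₀ * Real.exp (-κ * R ^ 2) := mul_comm _ _
  have hdom : ∀ x, f x ^ 2 * err x
      ≤ (ball (0 : EuclideanSpace ℝ (Fin 3)) (3 * R)).indicator
          (fun x => E₀ * Real.exp (-κ * R ^ 2) * f x ^ 2) x := by
    intro x
    by_cases hx : x ∈ ball (0 : EuclideanSpace ℝ (Fin 3)) (3 * R)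
    · rw [indicator_of_mem hx]
      rw [mem_ball_zero_iff] at hx
      rcases lt_or_ge ‖x‖ R with h | h
      · rw [herr_in x h, mul_zero]; positivity
      · have := (le_abs_self (err x)).trans (herr_bd x h hx.le)
        calc f x ^ 2 * err x ≤ f x ^ 2 * (E₀ * Real.exp (-κ * R ^ 2)) :=
              mul_le_mul_of_nonneg_left this (sq_nonneg _)
          _ = E₀ * Real.exp (-κ * R ^ 2) * f x ^ 2 := by ring
    · rw [indicator_of_notMem hx]
      rw [mem_ball_zero_iff, not_lt] at hx
      have hx' : x ∉ tsupport φ := fun h' => by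
        have := hφsupp h'
        rw [mem_closedBall_zero_iff] at this
        linarith
      rw [herr_out x hx', mul_zero]
  have hΔGV : Continuous fun x => ν * (Δ G) x + fderiv ℝ G x (U x - B x + a • x) :=
    (continuous_const.mul hΔG).add (hDG.clm_apply hVc)
  have i1 : Integrable fun x => f x ^ 2 * (φ x * (ν * (Δ G) x + fderiv ℝ G x (U x - B x + a • x))) :=
    ((hfc.pow 2).mul (hφcont.mul hΔGV)).integrable_of_hasCompactSupport (hφc.mul_right.mul_left)
  have i2 : Integrable fun x => f x ^ 2 * err x :=
    ((hfc.pow 2).mul herrc).integrable_of_hasCompactSupport herrcs.mul_left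
  have i3 : Integrable fun x => f x ^ 2 * (G x * φ x) :=
    ((hfc.pow 2).mul (hGc.mul hφcont)).integrable_of_hasCompactSupport (hφc.mul_left.mul_left)
  have i4 : Integrable ((ball (0 : EuclideanSpace ℝ (Fin 3)) (3 * R)).indicator
      (fun x => E₀ * Real.exp (-κ * R ^ 2) * f x ^ 2)) :=
    (((continuous_const.mul (hfc.pow 2)).continuousOn.integrableOn_compact
      (isCompact_closedBall (0 : EuclideanSpace ℝ (Fin 3)) (3 * R))).mono_set
        ball_subset_closedBall).integrable_indicator measurableSet_ball
  have hmainI : ∫ x, f x ^ 2 * (φ x * (ν * (Δ G) x + fderiv ℝ G x (U x - B x + a • x)))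
      ≤ a / 4 * ∫ x, f x ^ 2 * (G x * φ x) := by
    rw [← integral_const_mul]
    refine integral_mono i1 (i3.const_mul _) fun x => ?_
    have h := mul_le_mul_of_nonneg_left (hmain x) (mul_nonneg (sq_nonneg (f x)) (hφnn x))
    calc f x ^ 2 * (φ x * (ν * (Δ G) x + fderiv ℝ G x (U x - B x + a • x)))
        = f x ^ 2 * φ x * (ν * (Δ G) x + fderiv ℝ G x (U x - B x + a • x)) := by ring
      _ ≤ f x ^ 2 * φ x * (a / 4 * gaussProfile (-κ) x) := h
      _ = a / 4 * (f x ^ 2 * (G x * φ x)) := by rw [hGdef]; ring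
  have herrI : ∫ x, f x ^ 2 * err x
      ≤ E₀ * Real.exp (-κ * R ^ 2) * ∫ x in ball (0 : EuclideanSpace ℝ (Fin 3)) (3 * R), f x ^ 2 := by
    refine (integral_mono i2 i4 hdom).trans ?_
    rw [integral_indicator measurableSet_ball, integral_const_mul]
  have hsum : ∫ x, f x ^ 2 * (ν * (Δ fun y => G y * φ y) x
      + fderiv ℝ (fun y => G y * φ y) x (U x - B x + a • x))
      = (∫ x, f x ^ 2 * (φ x * (ν * (Δ G) x + fderiv ℝ G x (U x - B x + a • x))))
        + ∫ x, f x ^ 2 * err x := by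
    rw [← integral_add i1 i2]
    refine integral_congr_ae (Eventually.of_forall fun x => ?_)
    beta_reduce
    rw [hsplit x]
    ring
  rw [hsum] at hA
  linarith [hA, hmainI, herrI]

/-- **Energy Liouville theorem for the damped skew drift–Laplace equation (zero strain feed).**
Let `U ∈ C¹(ℝ³; ℝ³)` be bounded and divergence free, `B` skew, `ν, a > 0`, and let `f ∈ C²(ℝ³)`
solve `νΔf − Df[U − By + ay] = 2a f` with polynomially bounded MEAN SQUARES,
`∫_{B(0,R)} f² ≤ K (1 + R)^m` (`R ≥ 1`).  Then `f ≡ 0`.  (Gaussian-weighted energy identity with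
`κ = min(a/4ν, a²/4M²)`, cut-off errors `O(e^{−κR²} R^m) → 0`, then `∫_{B(0,ρ)} f² e^{−κ|y|²} = 0`
for every `ρ`.)  No maximum principle and no pointwise growth of `f` are used. [folklore] -/
theorem eq_zero_of_driftOp_eq_two_mul (hν : 0 < ν) (ha : 0 < a) (hB : ∀ x, ⟪B x, x⟫ = 0)
    (hU : ContDiff ℝ 1 U) (hdiv : VectorCalculus.IsDivFree U) (hbdd : ∃ M : ℝ, ∀ y, ‖U y‖ ≤ M)
    (hf : ContDiff ℝ 2 f) (heq : ∀ y, driftOp ν a (fun z => U z - B z) f y = 2 * a * f y)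
    (hgrowth : ∃ (K : ℝ) (m : ℕ), ∀ R : ℝ, 1 ≤ R →
      ∫ x in ball (0 : EuclideanSpace ℝ (Fin 3)) R, f x ^ 2 ≤ K * (1 + R) ^ m) :
    ∀ y, f y = 0 := by
  obtain ⟨M, hM⟩ := hbdd
  obtain ⟨K, m, hK⟩ := hgrowth
  set M₀ := max M 1 with hM₀def
  have hM₀ : ∀ y, ‖U y‖ ≤ M₀ := fun y => (hM y).trans (le_max_left _ _)
  have hM₀1 : 1 ≤ M₀ := le_max_right _ _
  have hM₀0 : 0 ≤ M₀ := by linarith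
  have hK0 : 0 ≤ K := by
    have h1 := hK 1 le_rfl
    have h0 : 0 ≤ ∫ x in ball (0 : EuclideanSpace ℝ (Fin 3)) 1, f x ^ 2 :=
      integral_nonneg fun x => sq_nonneg _
    by_contra hK'
    push Not at hK'
    have : K * (1 + 1 : ℝ) ^ m < 0 := mul_neg_of_neg_of_pos hK' (by positivity)
    linarith
  set κ := min (a / (4 * ν)) (a ^ 2 / (4 * M₀ ^ 2)) with hκdef
  have hκ0 : 0 < κ := lt_min (by positivity) (by positivity)
  have hκ1 : κ ≤ a / (4 * ν) := min_le_left _ _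
  have hκ2 : κ * M₀ ^ 2 ≤ a ^ 2 / 4 := by
    have h : κ ≤ a ^ 2 / (4 * M₀ ^ 2) := min_le_right _ _
    rw [le_div_iff₀ (by positivity)] at h
    linarith
  have hmain := fun y => gauss_weight_le (U := U) hν ha hB hM₀ hκ0 hκ1 hκ2 y
  obtain ⟨C₁, hC₁0, hC₁⟩ := exists_norm_fderiv_cutoff_le (E := EuclideanSpace ℝ (Fin 3))
  obtain ⟨C₂, hC₂0, hC₂⟩ := exists_abs_laplacian_cutoff_le (E := EuclideanSpace ℝ (Fin 3))
  set E₀ : ℝ := ν * C₂ + 36 * ν * κ * C₁ + C₁ * (M₀ + 3 * (‖B‖ + a)) with hE₀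
  have hE₀0 : 0 ≤ E₀ := by positivity
  set G : EuclideanSpace ℝ (Fin 3) → ℝ := gaussProfile (-κ) with hGdef
  have hGpos : ∀ x, 0 < G x := fun x => Real.exp_pos _
  have hGc : Continuous G := (contDiff_gaussProfile (-κ) (n := 0)).continuous
  have hfc : Continuous f := hf.continuous
  have hhc : Continuous fun x => f x ^ 2 * G x := (hfc.pow 2).mul hGc
  have hI : ∀ ρ : ℝ, 0 < ρ → ∫ x in ball (0 : EuclideanSpace ℝ (Fin 3)) ρ, f x ^ 2 * G x = 0 := by
    intro ρ hρ
    set I := ∫ x in ball (0 : EuclideanSpace ℝ (Fin 3)) ρ, f x ^ 2 * G x with hIdef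
    have hInn : 0 ≤ I := integral_nonneg fun x => mul_nonneg (sq_nonneg _) (hGpos x).le
    set D : ℝ := (m + 1).factorial * 4 ^ m / κ ^ (m + 1) with hDdef
    have hD0 : 0 ≤ D := by positivity
    set Cf : ℝ := 1 / 2 * (E₀ * K) * D with hCf
    have hCf0 : 0 ≤ Cf := by positivity
    have hbound : ∀ R : ℝ, max ρ 1 ≤ R → 3 * a / 8 * I ≤ Cf / R := by
      intro R hR
      have hR1 : 1 ≤ R := (le_max_right _ _).trans hR
      have hρR : ρ ≤ R := (le_max_left _ _).trans hR
      have hR0 : 0 < R := by linarith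
      have hest := energy_cutoff_estimate hν ha hB hU hdiv hf heq hM₀0 hM₀ hκ0 hmain hC₁0 hC₂0
        hC₁ hC₂ hR1
      have iw : Integrable fun x => f x ^ 2 * (G x * cutoff R x) :=
        ((hfc.pow 2).mul (hGc.mul (contDiff_cutoff (n := 0) R).continuous)).integrable_of_hasCompactSupport
          ((hasCompactSupport_cutoff hR0).mul_left.mul_left)
      have hIle : I ≤ ∫ x, f x ^ 2 * (G x * cutoff R x) := by
        have h1 : ∫ x in ball (0 : EuclideanSpace ℝ (Fin 3)) ρ, f x ^ 2 * (G x * cutoff R x)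
            ≤ ∫ x, f x ^ 2 * (G x * cutoff R x) :=
          setIntegral_le_integral iw (ae_of_all _ fun x =>
            mul_nonneg (sq_nonneg _) (mul_nonneg (hGpos x).le (cutoff_nonneg _ _)))
        have h2 : ∫ x in ball (0 : EuclideanSpace ℝ (Fin 3)) ρ, f x ^ 2 * (G x * cutoff R x) = I := by
          refine setIntegral_congr_fun measurableSet_ball fun x hx => ?_
          rw [mem_ball_zero_iff] at hx
          simp only [cutoff_eq_one hR0 (by linarith : ‖x‖ ≤ R), mul_one]
        linarith
      have hgr := hK (3 * R) (by linarith)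
      have hdec := exp_neg_mul_sq_poly_le hκ0 hR1 m
      have hexp0 : 0 ≤ Real.exp (-κ * R ^ 2) := (Real.exp_pos _).le
      have s1 : 3 * a / 8 * I ≤ 3 * a / 8 * ∫ x, f x ^ 2 * (G x * cutoff R x) :=
        mul_le_mul_of_nonneg_left hIle (by positivity)
      have s3 : 1 / 2 * (E₀ * Real.exp (-κ * R ^ 2))
            * (∫ x in ball (0 : EuclideanSpace ℝ (Fin 3)) (3 * R), f x ^ 2)
          ≤ 1 / 2 * (E₀ * Real.exp (-κ * R ^ 2)) * (K * (1 + 3 * R) ^ m) :=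
        mul_le_mul_of_nonneg_left hgr (by positivity)
      have s5 : Real.exp (-κ * R ^ 2) * (1 + 3 * R) ^ m ≤ D / R := by
        rw [le_div_iff₀ hR0]
        exact hdec
      have s6 : 1 / 2 * (E₀ * Real.exp (-κ * R ^ 2)) * (K * (1 + 3 * R) ^ m)
          = 1 / 2 * (E₀ * K) * (Real.exp (-κ * R ^ 2) * (1 + 3 * R) ^ m) := by ring
      have s7 : 1 / 2 * (E₀ * K) * (Real.exp (-κ * R ^ 2) * (1 + 3 * R) ^ m)
          ≤ 1 / 2 * (E₀ * K) * (D / R) := mul_le_mul_of_nonneg_left s5 (by positivity)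
      have s8 : 1 / 2 * (E₀ * K) * (D / R) = Cf / R := by rw [hCf]; ring
      linarith [s1, hest, s3, s6, s7, s8]
    by_contra hI0
    have hIpos : 0 < I := lt_of_le_of_ne hInn (Ne.symm hI0)
    have hc : 0 < 3 * a / 8 * I := by positivity
    set R := max (max ρ 1) (Cf / (3 * a / 8 * I) + 1) with hRdef
    have hR : max ρ 1 ≤ R := le_max_left _ _
    have hR0 : 0 < R := lt_of_lt_of_le (lt_of_lt_of_le one_pos (le_max_right _ _)) hR
    have hRgt : Cf / (3 * a / 8 * I) < R :=
      lt_of_lt_of_le (lt_add_one _) (le_max_right _ _)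
    have h1 := hbound R hR
    rw [div_lt_iff₀ hc] at hRgt
    rw [le_div_iff₀ hR0] at h1
    linarith
  intro y
  by_contra hy
  set ρ := ‖y‖ + 1 with hρdef
  have hρ : 0 < ρ := by positivity
  have hpos : 0 < ∫ x in ball (0 : EuclideanSpace ℝ (Fin 3)) ρ, f x ^ 2 * G x := by
    rw [setIntegral_pos_iff_support_of_nonneg_ae (ae_of_all _ fun x =>
      mul_nonneg (sq_nonneg _) (hGpos x).le)
      ((hhc.continuousOn.integrableOn_compact (isCompact_closedBall _ _)).mono_set
        ball_subset_closedBall)]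
    refine IsOpen.measure_pos _ ((isOpen_ne_fun hhc continuous_const).inter isOpen_ball) ⟨y, ?_, ?_⟩
    · show f y ^ 2 * G y ≠ 0
      exact mul_ne_zero (pow_ne_zero 2 hy) (hGpos y).ne'
    · rw [mem_ball_zero_iff, hρdef]; linarith
  exact absurd (hI ρ hρ) hpos.ne'

end Liouville

end Summit.NavierStokesRegularity.NavierStokesRegularity.Theorems.CoriolisHead

end
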